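import Literature.Computability.AlgebraicComplexity.MatMulRankGF2Wang
import Literature.Computability.AlgebraicComplexity.MatMulRankLowerBoundsBlaserProofs
import Mathlib.Data.ZMod.Basic
import HarnessLib

/-!
# Wang 2026, `R_{𝔽₂}(⟨3,3,3⟩) ≥ 20`: readings over rings that map to `𝔽₂` (ℤ, ℤ/2ᵏ, every two-element field)

Topic `Literature/Computability/AlgebraicComplexity` (bilinear complexity of small formats over finite
fields). THEOREMS ONLY, all conditional on the tree's named fact `Wang2026_thm1`
(`MatMulRankGF2Wang.lean`: Wang 2026, Theorem 1, verbatim — `R_{𝔽₂}(⟨2,3,4⟩) ≥ 19`,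
`R_{𝔽₂}(⟨3,3,3⟩) ≥ 20`, `R_{𝔽₂}(⟨3,3,4⟩) ≥ 25`, `R_{𝔽₂}(⟨3,4,4⟩) ≥ 29`, over `ZMod 2`). No definitions,
no new named facts. (An earlier version of this file carried a second name,
`wang2026_rank_matMulTensor_333_F2`, for the `⟨3,3,3⟩` clause; it was proposed in the same minute as
`Wang2026_thm1` and is REMOVED here as a duplicate — use `Wang2026_thm1.matMul333`.)

What is added: the transport of the headline bound along ring homomorphisms INTO `𝔽₂`. Bläser 1999,
§5 eq. (10) (tree: `tensorRank_matMulTensor_map_le`): a ring homomorphism `f : R → L` maps every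
bilinear scheme for `⟨k,m,n⟩` over `R` to one over `L` with the same number of products, so
`R_L(⟨k,m,n⟩) ≤ R_R(⟨k,m,n⟩)`. Hence Wang's `𝔽₂` bound is a bound over every commutative
(semi)ring that maps onto `𝔽₂`:

* `Wang2026_thm1.of_ringHom` — `20 ≤ R_R(⟨3,3,3⟩)` for every commutative semiring `R` with a ring
  homomorphism `R → ZMod 2`;
* `Wang2026_thm1.int` — over `ℤ`: no `3 × 3` scheme with integer coefficients has `≤ 19` products
  (the schemes found by flip-graph walks over `ℤ₂` and lifted to `ℤ`, Kauers–Moosbauer 2022 §5, live here);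
* `Wang2026_thm1.zmod_two_pow` — over `ℤ/2ᵏ`, `k ≥ 1` (the Hensel-lifting stages `ℤ₂ → ℤ₄ → …`);
* `Wang2026_thm1.card_two` — over every field with two elements (`ZMod 2 ≃+* F`).

SCOPE, as printed (Wang 2026 §8, Table 3): `𝔽₂`-specific. Nothing follows for `ℚ`, `ℝ`, `ℂ`, `𝔽₃`, …
(no homomorphism to `𝔽₂`), where the printed bound remains Bläser's `19` (`blaser2003_cor9_holds`).

## References

* [Wang2026] C. Wang, *Automated Lower Bounds for Bilinear Complexity over Finite Fields*,
  arXiv:2603.07280 (2026) — Theorem 1, §8, Table 3.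
* [Blaser1999] M. Bläser, Comput. Complexity 8 (1999) 203–226 — §5 eq. (10) (base change).
* [KauersMoosbauer2022FlipGraphs] M. Kauers, J. Moosbauer, *Flip graphs for matrix multiplication*,
  ISSAC 2023, arXiv:2212.01175 — §5 (schemes over `ℤ₂`, lifting to `ℤ`).
-/

namespace Literature.Computability.AlgebraicComplexity

namespace Wang2026_thm1

/-- **Transport into `𝔽₂`**: if a commutative semiring `R` admits a ring homomorphism `f : R → ZMod 2`,
then every `3 × 3` matrix multiplication scheme over `R` has at least `20` products
(`R_{𝔽₂} ≤ R_R` along `f`, Bläser 1999 §5 (10), and Wang's `R_{𝔽₂}(⟨3,3,3⟩) ≥ 20`).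
[cite: Wang2026, Thm. 1] [cite: Blaser1999, §5 eq. (10)] -/
theorem of_ringHom (h : Wang2026_thm1) {R : Type*} [CommSemiring R] (f : R →+* ZMod 2) :
    20 ≤ tensorRank (matMulTensor R 3 3 3) :=
  h.matMul333.trans (tensorRank_matMulTensor_map_le f 3 3 3)

/-- **Over the integers**: `20 ≤ R_ℤ(⟨3,3,3⟩)` — no bilinear scheme with integer coefficients and
`≤ 19` products (reduce mod `2`). [cite: Wang2026, Thm. 1] [cite: Blaser1999, §5 eq. (10)] -/
theorem int (h : Wang2026_thm1) : 20 ≤ tensorRank (matMulTensor ℤ 3 3 3) :=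
  h.of_ringHom (Int.castRingHom (ZMod 2))

/-- **Over `ℤ/2ᵏ`** (`k ≥ 1`), the rings of the Hensel-lifting stages `ℤ₂ → ℤ₄ → ℤ₈ → …`:
`20 ≤ R_{ℤ/2ᵏ}(⟨3,3,3⟩)` (reduce mod `2`). [cite: Wang2026, Thm. 1] [cite: Blaser1999, §5 eq. (10)] -/
theorem zmod_two_pow (h : Wang2026_thm1) {k : ℕ} (hk : 1 ≤ k) :
    20 ≤ tensorRank (matMulTensor (ZMod (2 ^ k)) 3 3 3) :=
  h.of_ringHom (ZMod.castHom (dvd_pow_self 2 (by omega)) (ZMod 2))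

/-- **Over every field with two elements** (such a field is `ZMod 2` up to a ring isomorphism):
`20 ≤ R_F(⟨3,3,3⟩)`. [cite: Wang2026, Thm. 1] [cite: Blaser1999, §5 eq. (10)] -/
theorem card_two (h : Wang2026_thm1) (F : Type*) [Field F] [Fintype F] (hF : Fintype.card F = 2) :
    20 ≤ tensorRank (matMulTensor F 3 3 3) :=
  h.of_ringHom ((ZMod.ringEquivOfPrime F Nat.prime_two hF).symm : F →+* ZMod 2)

end Wang2026_thm1

end Literature.Computability.AlgebraicComplexity
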